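import Summits.BirchSwinnertonDyer.Rank1Residual.Additive.GordDescentModelFree
import HarnessLib

/-!
# X3♯(G-ord) / X4♯(G-ord) at `p = 3` (Kodaira `I₀*`, twist `E^{(−3)}` good at `3`): the class theorems MODEL-FREE

HONEST FRAMING (cell `b2b-bsdres`, run/shared/lean/b2b/bsd-rank1-residual/, verbatim in every
file): the goal of the cell is to DELETE the COMBINATION-SHAPED residual classes of the
Birch–Swinnerton-Dyer formula for ALL analytic-rank `≤ 1` elliptic curves over `ℚ` — "full BSD
formula for every rank `≤ 1` curve in class `C`" assembled STRICTLY from published theorems — so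
that the rank-`≤ 1` remainder becomes exactly the CONSTRUCTION-SHAPED classes, which are TYPED
(missing-input `Prop`s), NOT attempted. This is not "finishing BSD". Sub-cell `additive-p2`
(CLASS-OWNERS row "X3/X4 additive — pot. good ordinary / X3♯(G-ord)"), generation 4: research
route; no claim beyond the stated classes; theorems only, no definition, no new named fact;
X3♯(G-ord)/X4♯(G-ord) stay CONSTRUCTION-SHAPED.

WHAT THIS FILE DOES. The `p = 3` twin of `GordDescentModelFree.lean` / `…Cases.lean`. At `p = 3`
ALL 421 census pairs of X3♯(G-ord) ∪ X4♯(G-ord) are of Kodaira type `I₀*` with `E^{(−3)}` good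
ordinary at `3` (AUDIT-X34-GORD.md §3; TWIST-CENSUS.md: X4 151, X3 270), but — unlike `p ≥ 5` —
good reduction of the twist at the wild prime `3` is NOT a consequence of `ord_3 Δ_min ≡ 6 (mod 12)`;
it stays a hypothesis, stated model-free ("every globally minimal model of `E^{(−3)}` is good at `3`",
equivalently one is). Everything else is discharged as at `p ≥ 5`: the quadratic field `ℚ(√−3)`
(`d_K = −3 = 3*`) is constructed, ORDINARITY of the twist follows from the theory class (gen 4
`goodOrd_of_typeGOrd_of_hasGoodReductionAtPrime`, any odd `p`) or, on X3, from reducibility (gen 3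
`goodOrd_twist_of_red`), surjectivity of `ρ̄_{E,3}` transports to the twist (gen 3
`surj_iff_of_model_twist`), and the over-`K` input is additive-p1's model-free
`MissingPPartOverCAt (W.baseChange K) 3` (Milne any-model).

* `bsdp_twist_three_of_classX4_of_surj` — `(E,3) ∈ X4`, `Surj W 3`, a globally minimal
  `Wd ≅ E^{(−3)}` good ordinary at `3` of analytic rank `≤ 1`: `BSD(Wd, 3)` (row C16: Yan–Zhu 2026
  Thm. 4.15 at `p = 3` with (Im) from surj(3), `hYZ`, `hW20`).
* **`bsdp_iff_overC_three_of_classX4Gord_of_surj`** — `(E,3) ∈ X4♯(G-ord)` (`TypeGOrd W 3`),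
  `E^{(−3)}` good at `3`, `Surj W 3`, `r_an(E) ≤ 1`, `r_an(E^{(−3)}) ≤ 1`, any quadratic `K` with
  `d_K = −3`: `BSDp W 3 ↔ MissingPPartOverCAt (W.baseChange K) 3`; `bsdp_three_of_classX4Gord_of_surj`
  (the `∀ K` form).
* **`bsdp_three_of_classX3_cases`** — `(E,3) ∈ X3`, `E^{(−3)}` good at `3`, ranks `≤ 1`: `BSD(E,3)` ⇐
  over-`K` input ∧ [typed X1 input of the twist pair if of class X1] (census: 221 of 270 twist
  pairs are X1 at `3`; 48 Covered; 1 of twist rank 2).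

Located gap UNCHANGED; nothing here books a pair.

References: X. Yan, X. Zhu, arXiv:2412.20078 Thm. 4.15 (§4.6); C. Wuthrich, Doc. Math. 19 (2014)
381–402, Lemma 20, Prop. 21; J. S. Milne, Invent. Math. 17 (1972) Thm. 1; J.-P. Serre, Invent. Math.
15 (1972) Prop. 12.
-/

noncomputable section

open scoped Classical NumberField

open WeierstrassCurve IsDedekindDomain NumberField Literature.NumberTheory.EllipticCurves
  Literature.NumberTheory.EllipticCurves.Rank1Residual
  Literature.NumberTheory.EllipticCurves.Rank1Residual.Typed
  Literature.NumberTheory.EllipticCurves.ModularForms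
  Literature.NumberTheory.EllipticCurves.Wuthrich2014
  Summit.BirchSwinnertonDyer.Rank1Residual.AdditivePotMult

namespace Summit.BirchSwinnertonDyer.Rank1Residual.Additive

variable (W : WeierstrassCurve ℚ) [W.IsElliptic] [W.IsGloballyMinimal] [hp : Fact (3 : ℕ).Prime]

omit hp in
/-- `3* = −3`: the twist parameter of the dictionary at `p = 3`. -/
theorem pStar_three : ((-1 : ℚ) ^ ((3 : ℕ) / 2) * (3 : ℕ)) = -3 := by norm_num

/-! ### X4♯(G-ord) at `p = 3` with surj(3) -/

section X4

variable (Wd : WeierstrassCurve ℚ) [Wd.IsElliptic] [Wd.IsGloballyMinimal]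

omit [W.IsGloballyMinimal] in
/-- **`BSD(E^{(−3)}, 3)` for the twist pair of an X4 pair with `ρ̄_{E,3}` onto** (row C16: `p = 3`,
good ordinary, irreducible, surj — Yan–Zhu 2026 Thm. 4.15 `hYZ` with Wuthrich Lemma 20 `hW20`):
surjectivity and irreducibility transport to the twist (`surj_iff_of_model_twist`,
`irr_iff_of_model_twist`). [cite: YanZhu2024MainConjNonCM, Thm. 4.15 (§4.6)] -/
theorem bsdp_twist_three_of_classX4_of_surj (hYZ : YanZhu2026.thm415_padicValRat_bsd_rank_le_one)
    (hW20 : Wuthrich2014.lemma20_surjective_threeAdic_of_semistable)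
    (hmod : hasEntireLFunction_rat) (hGZK : rank_eq_analyticRank_of_analyticRank_le_one)
    (hX : ClassX4 W 3) (hsurj : Surj W 3)
    (hWd : ∃ C : VariableChange ℚ, C • W.quadraticTwist ((-1 : ℚ) ^ ((3 : ℕ) / 2) * (3 : ℕ)) = Wd)
    (hord : GoodOrd Wd 3) (hrd : Wd.analyticRank ≤ 1) : BSDp Wd 3 := by
  have hsurjd : Surj Wd 3 := (surj_iff_of_model_twist W 3 (pStar_ne_zero 3) hWd).mpr hsurj
  have hirr : Irr Wd 3 := (irr_iff_of_model_twist (pStar_ne_zero 3) hWd).mpr hX.2.2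
  exact RowC16.bsdp hYZ hW20 hmod hGZK hrd ⟨rfl, hord, hirr, Or.inl hsurjd⟩

/-- **Exact relocation at `p = 3`, model-free (X4♯(G-ord) ∩ {`E^{(−3)}` good at `3`}, surj(3)).** For
`(E,3) ∈ X4♯(G-ord)` (`ClassX4Gord W 3`) such that the globally minimal models of `E^{(−3)}` have
good reduction at `3` (`hgood`; then ORDINARY by `goodOrd_of_typeGOrd_of_hasGoodReductionAtPrime`),
`ρ̄_{E,3}` onto, `r_an(E) ≤ 1`, `r_an(E^{(−3)}) ≤ 1`, and ANY quadratic `K` with `d_K = −3`: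
**`BSDp W 3 ↔ MissingPPartOverCAt (W.baseChange K) 3`** (twist pair row C16 `hYZ`/`hW20`; Milne
any-model `hMilneC`; GZK; modularity). [cite: YanZhu2024MainConjNonCM, Thm. 4.15 (§4.6)] -/
theorem bsdp_iff_overC_three_of_classX4Gord_of_surj
    (hYZ : YanZhu2026.thm415_padicValRat_bsd_rank_le_one)
    (hW20 : Wuthrich2014.lemma20_surjective_threeAdic_of_semistable)
    (hGZK : rank_eq_analyticRank_of_analyticRank_le_one) (hmod : hasEntireLFunction_rat)
    (hMilneC : Milne1972.bsdQuotient_baseChange_quadratic_anyModel)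
    (hX : ClassX4Gord W 3) (hsurj : Surj W 3) (hr : W.analyticRank ≤ 1)
    (hgood : ∀ (Wd : WeierstrassCurve ℚ) [Wd.IsElliptic] [Wd.IsGloballyMinimal],
      (∃ C : VariableChange ℚ, C • W.quadraticTwist ((-1 : ℚ) ^ ((3 : ℕ) / 2) * (3 : ℕ)) = Wd) →
      Wd.HasGoodReductionAtPrime 3)
    (hrd : (W.quadraticTwist ((-1 : ℚ) ^ ((3 : ℕ) / 2) * (3 : ℕ))).analyticRank ≤ 1)
    (K : Type) [Field K] [NumberField K] (h2 : Module.finrank ℚ K = 2)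
    (hdK : (NumberField.discr K : ℚ) = (-1 : ℚ) ^ ((3 : ℕ) / 2) * (3 : ℕ)) :
    BSDp W 3 ↔ MissingPPartOverCAt (W.baseChange K) 3 := by
  haveI := W.isElliptic_quadraticTwist (pStar_ne_zero 3)
  obtain ⟨C, hCmin⟩ :=
    hasGlobalMinimalModel_rat_holds (W.quadraticTwist ((-1 : ℚ) ^ ((3 : ℕ) / 2) * (3 : ℕ)))
  haveI := hCmin
  set Wd := C • W.quadraticTwist ((-1 : ℚ) ^ ((3 : ℕ) / 2) * (3 : ℕ)) with hWd_def
  have hC : C • W.quadraticTwist ((-1 : ℚ) ^ ((3 : ℕ) / 2) * (3 : ℕ)) = Wd := rfl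
  have hord : GoodOrd Wd 3 :=
    goodOrd_of_typeGOrd_of_hasGoodReductionAtPrime W 3 (by omega) hX.typeGOrd Wd ⟨C, hC⟩
      (hgood Wd ⟨C, hC⟩)
  have hrd' : Wd.analyticRank ≤ 1 := by rw [← hC, analyticRank_smul]; exact hrd
  have hWdK : ∃ C : VariableChange ℚ, C • W.quadraticTwist (NumberField.discr K : ℚ) = Wd := by
    rw [hdK]; exact ⟨C, hC⟩
  have hd : BSDp Wd 3 :=
    bsdp_twist_three_of_classX4_of_surj W Wd hYZ hW20 hmod hGZK hX.classX4 hsurj ⟨C, hC⟩ hord hrd'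
  exact (missingPPartOverCAt_baseChange_iff_bsdp W 3 K Wd hGZK hmod hMilneC hr h2 hWdK hrd' hd).symm

/-- **X4♯(G-ord) at `p = 3`, surj(3) — `BSD(E,3)` from the over-`K` input ALONE, model-free**
(`K = ℚ(√−3)` constructed, `exists_quadraticField_discr_pStar`). [cite: YanZhu2024MainConjNonCM, Thm. 4.15 (§4.6)] -/
theorem bsdp_three_of_classX4Gord_of_surj
    (hYZ : YanZhu2026.thm415_padicValRat_bsd_rank_le_one)
    (hW20 : Wuthrich2014.lemma20_surjective_threeAdic_of_semistable)
    (hGZK : rank_eq_analyticRank_of_analyticRank_le_one) (hmod : hasEntireLFunction_rat)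
    (hMilneC : Milne1972.bsdQuotient_baseChange_quadratic_anyModel)
    (hX : ClassX4Gord W 3) (hsurj : Surj W 3) (hr : W.analyticRank ≤ 1)
    (hgood : ∀ (Wd : WeierstrassCurve ℚ) [Wd.IsElliptic] [Wd.IsGloballyMinimal],
      (∃ C : VariableChange ℚ, C • W.quadraticTwist ((-1 : ℚ) ^ ((3 : ℕ) / 2) * (3 : ℕ)) = Wd) →
      Wd.HasGoodReductionAtPrime 3)
    (hrd : (W.quadraticTwist ((-1 : ℚ) ^ ((3 : ℕ) / 2) * (3 : ℕ))).analyticRank ≤ 1)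
    (hK : ∀ (K : Type) [Field K] [NumberField K], Module.finrank ℚ K = 2 →
      (NumberField.discr K : ℚ) = (-1 : ℚ) ^ ((3 : ℕ) / 2) * (3 : ℕ) →
        MissingPPartOverCAt (W.baseChange K) 3) :
    BSDp W 3 := by
  obtain ⟨K, iF, iN, h2, hdK⟩ := exists_quadraticField_discr_pStar 3 (by omega)
  exact (bsdp_iff_overC_three_of_classX4Gord_of_surj W hYZ hW20 hGZK hmod hMilneC hX hsurj hr hgood
    hrd K h2 hdK).mpr (hK K h2 hdK)

end X4

/-! ### X3♯(G-ord) at `p = 3` -/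

section X3

/-- **X3 at `p = 3` (Kodaira `I₀*`, `E^{(−3)}` good at `3`) — the complete relocation, model-free.**
For `(E,3) ∈ X3` (reducible `E[3]`, additive `3`) of analytic rank `≤ 1` whose twist `E^{(−3)}` has
good reduction at `3` on its globally minimal models (then good ORDINARY: gen 3
`goodOrd_twist_of_red`, Serre 1972 Prop. 12) and `r_an(E^{(−3)}) ≤ 1`: `BSD(E,3)` follows from the
over-`K` input `MissingPPartOverCAt (W.baseChange K) 3` for the quadratic fields of discriminant
`−3` TOGETHER WITH the cell's typed X1 input of the twist pair when that pair is of class X1 (census: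
221 of the 270 pairs), and from nothing else (Covered twist pairs: rows C6/C7/C8/C10). No
`TypeGOrd` hypothesis is needed here (it follows: gen 0 `classX3Gord_of_goodOrd_quadraticTwist`).
[cite: Wuthrich2014, Prop. 21 (p. 400)] -/
theorem bsdp_three_of_classX3_cases (hSk : Skinner2016.thmC_padicValRat_bsd_rank_zero)
    (hBCS : BurungaleCastellaSkinner2025.cor131_padicValRat_bsd_rank_le_one)
    (hJSW : JetchevSkinnerWan2017.thm121_padicValRat_bsd_rank_one)
    (hCGS : CastellaGrossiSkinner2025.thmD_padicValRat_bsd_rank_le_one)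
    (hGV : GreenbergVatsal2000.thm13_charIdeal_eq_of_gvPar) (hGr : greenberg_charValue_rankZero)
    (hmod : hasEntireLFunction_rat) (hmodP : nonempty_modularParametrizationData)
    (hGZK : rank_eq_analyticRank_of_analyticRank_le_one)
    (hCM : bsdTriple_of_hasCM_of_L_one_ne_zero) (hKob : Kobayashi2013.cor14_bsdp_of_cm_rank_one)
    (hYZ : YanZhu2026.thm415_padicValRat_bsd_rank_le_one)
    (hW20 : Wuthrich2014.lemma20_surjective_threeAdic_of_semistable)
    (hLLT : LiLiuTian2024.thm11_bsdp_of_cm_rank_one) (hW : sha_dvd_analyticSha)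
    (hMilneC : Milne1972.bsdQuotient_baseChange_quadratic_anyModel)
    (hX : ClassX3 W 3) (hr : W.analyticRank ≤ 1)
    (hgood : ∀ (Wd : WeierstrassCurve ℚ) [Wd.IsElliptic] [Wd.IsGloballyMinimal],
      (∃ C : VariableChange ℚ, C • W.quadraticTwist ((-1 : ℚ) ^ ((3 : ℕ) / 2) * (3 : ℕ)) = Wd) →
      Wd.HasGoodReductionAtPrime 3)
    (hrd : (W.quadraticTwist ((-1 : ℚ) ^ ((3 : ℕ) / 2) * (3 : ℕ))).analyticRank ≤ 1)
    (hK : ∀ (K : Type) [Field K] [NumberField K], Module.finrank ℚ K = 2 →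
      (NumberField.discr K : ℚ) = (-1 : ℚ) ^ ((3 : ℕ) / 2) * (3 : ℕ) →
        MissingPPartOverCAt (W.baseChange K) 3)
    (hX1 : ∀ (Wd : WeierstrassCurve ℚ) [Wd.IsElliptic] [Wd.IsGloballyMinimal],
      (∃ C : VariableChange ℚ, C • W.quadraticTwist ((-1 : ℚ) ^ ((3 : ℕ) / 2) * (3 : ℕ)) = Wd) →
      ClassX1 Wd 3 → X1.MissingInputAt Wd 3) :
    BSDp W 3 := by
  obtain ⟨K, iF, iN, h2, hdK⟩ := exists_quadraticField_discr_pStar 3 (by omega)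
  haveI := W.isElliptic_quadraticTwist (pStar_ne_zero 3)
  obtain ⟨C, hCmin⟩ :=
    hasGlobalMinimalModel_rat_holds (W.quadraticTwist ((-1 : ℚ) ^ ((3 : ℕ) / 2) * (3 : ℕ)))
  haveI := hCmin
  set Wd := C • W.quadraticTwist ((-1 : ℚ) ^ ((3 : ℕ) / 2) * (3 : ℕ)) with hWd_def
  have hC : C • W.quadraticTwist ((-1 : ℚ) ^ ((3 : ℕ) / 2) * (3 : ℕ)) = Wd := rfl
  have hord : GoodOrd Wd 3 :=
    goodOrd_twist_of_red W 3 (by omega) hX.1 (pStar_ne_zero 3) Wd ⟨C, hC⟩ (hgood Wd ⟨C, hC⟩)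
  have hrd' : Wd.analyticRank ≤ 1 := by rw [← hC, analyticRank_smul]; exact hrd
  have hWdK : ∃ C : VariableChange ℚ, C • W.quadraticTwist (NumberField.discr K : ℚ) = Wd := by
    rw [hdK]; exact ⟨C, hC⟩
  have hd : BSDp Wd 3 :=
    bsdp_twist_pStar_of_classX3_cases W 3 Wd hSk hBCS hJSW hCGS hGV hGr hmod hmodP hGZK hCM hKob hYZ
      hW20 hLLT hW hX (by omega) ⟨C, hC⟩ hord hrd' (hX1 Wd ⟨C, hC⟩)
  exact bsdp_of_pPartOverC_baseChange W 3 K Wd hGZK hmod hMilneC hr h2 hWdK hrd' (hK K h2 hdK) hd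

omit [W.IsGloballyMinimal] in
/-- The theory-class bookkeeping at `p = 3`: an X3 pair whose twist `E^{(−3)}` is good at `3` IS an
X3♯(G-ord) pair (`ClassX3Gord W 3`), with no ordinarity datum (gen 3 `goodOrd_twist_of_red` + gen 0
`classX3Gord_of_goodOrd_quadraticTwist`). [cite: Serre1972, §1.11 Prop. 12] -/
theorem classX3Gord_three_of_good_twist (hX : ClassX3 W 3)
    (hgood : ∀ (Wd : WeierstrassCurve ℚ) [Wd.IsElliptic] [Wd.IsGloballyMinimal],
      (∃ C : VariableChange ℚ, C • W.quadraticTwist ((-1 : ℚ) ^ ((3 : ℕ) / 2) * (3 : ℕ)) = Wd) →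
      Wd.HasGoodReductionAtPrime 3) :
    ClassX3Gord W 3 := by
  haveI := W.isElliptic_quadraticTwist (pStar_ne_zero 3)
  obtain ⟨C, hCmin⟩ :=
    hasGlobalMinimalModel_rat_holds (W.quadraticTwist ((-1 : ℚ) ^ ((3 : ℕ) / 2) * (3 : ℕ)))
  haveI := hCmin
  set Wd := C • W.quadraticTwist ((-1 : ℚ) ^ ((3 : ℕ) / 2) * (3 : ℕ)) with hWd_def
  have hC : C • W.quadraticTwist ((-1 : ℚ) ^ ((3 : ℕ) / 2) * (3 : ℕ)) = Wd := rfl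
  have hord : GoodOrd Wd 3 :=
    goodOrd_twist_of_red W 3 (by omega) hX.1 (pStar_ne_zero 3) Wd ⟨C, hC⟩ (hgood Wd ⟨C, hC⟩)
  exact classX3Gord_of_goodOrd_quadraticTwist W 3 (by omega) hX Wd C hC hord

end X3

end Summit.BirchSwinnertonDyer.Rank1Residual.Additive

end
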